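import Literature.NumberTheory.EllipticCurves.TwoAdicImageSurjectivityModTwoProofs
import Literature.NumberTheory.EllipticCurves.ZpExtension
import Mathlib.GroupTheory.Perm.Sign
import HarnessLib

/-!
# Route ByReductionTypeAtTwo, crux `OrdKatoHalfAtTwoIso` (stmt-BirchSwinnertonDyer-19573), line
# `steinberg-fibre-at-two` v4: helper W-D — on the residue, `ρ̄_{E,2}` restricted to `Gal(ℚ̄/ℚ_∞)` is
# still onto `S₃`; in particular some `σ₀ ∈ Gal(ℚ̄/ℚ_∞)` acts on `E[2]` without nonzero fixed point

HONEST FRAMING (cell bsd-2adic): BSD is not proved by any of this; the crux `OrdKatoHalfAtTwoIso` is NOT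
proved here; nothing is booked. This file is a KERNEL HELPER (device (D) of the port map of the line
`Cruxes/OrdKatoHalfAtTwoIso/Lines/steinberg_fibre_at_two.lean`; it is not one of the line's registered
stubs): a residue Galois-image fact used by both roads of `stub_port` and by socket 2's memo.

Setting. `W/ℚ` elliptic, `E[2] ∖ 0 = {T₀, T₁, T₂}` (tree `DokchitserDokchitser2012.T`), and
`permGal W _ σ ∈ S₃` the permutation of the three letters induced by `σ ∈ Γ_ℚ`
(`σ T_i = T_{permGal σ i}`, multiplicative in `σ`; Silverman *AEC* III.§7). `κ : ZpExtension ℚ 2` is ANY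
`ℤ₂`-extension of `ℚ` (Washington §13.1; in the application the cyclotomic one), `κ.kerSubgroup =
Gal(ℚ̄/ℚ_∞) ⊴ Γ_ℚ` its kernel.

Contents (all sorry-free, no named fact, no instance):

* (G) `perm_fin_three_subgroup_eq_top_of_normal_of_exists_sign_eq_neg_one` — a normal subgroup of `S₃`
  containing an odd permutation is `S₃` (an odd permutation of three letters is a transposition, all
  transpositions are conjugate, and transpositions generate; Mathlib `Equiv.Perm.isConj_swap`,
  `Equiv.Perm.closure_isSwap`).
* (S) `permGal_surjective_of_hasSurjectiveModNGaloisRep_two` — the dictionary «`ρ̄_{E,2}` onto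
  `Aut(E[2])`» ⇒ «`σ ↦ permGal σ` onto `S₃`» (the transposition `T₀ ↔ T₁` = `swapAut` and an
  automorphism moving `T₂` are realised, and the realised permutations are closed under products).
* (D) `permGal_kerSubgroup_surjective_of_sign_eq_neg_one` — if `ρ̄_{E,2}` is onto and some
  `c ∈ κ.kerSubgroup` is ODD on `E[2]` (on the residue: complex conjugation, which lies in the kernel of
  every `ℤ₂`-extension and is a transposition when `Δ < 0` — the latter is the neighbouring helper W-Δ and
  enters here only as the hypothesis `hc`), then `permGal` restricted to `κ.kerSubgroup` is still onto
  `S₃`: the image of the normal subgroup `κ.kerSubgroup` under the epimorphism `Γ_ℚ ↠ S₃` is normal and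
  contains an odd element, so it is `S₃` by (G).
* (F) `exists_mem_kerSubgroup_forall_smul_ne` — the consumer shape: some `σ₀ ∈ κ.kerSubgroup` acts on
  `E[2]` as a `3`-cycle, i.e. moves every nonzero `2`-torsion point.

References: J. H. Silverman, *The Arithmetic of Elliptic Curves*, 2nd ed., GTM 106 (2009), III.§7
[SilvermanAEC2009]; L. C. Washington, *Introduction to Cyclotomic Fields*, 2nd ed., GTM 83 (1997), §13.1
[Washington1997]; T. Dokchitser, V. Dokchitser, Math. Z. 272 (2012) 961–964, Theorem (1)
[DokchitserDokchitserMathZ2012].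
-/

set_option autoImplicit false
set_option linter.dupNamespace false

/-! ### §0. Permutations of three letters (kernel-decidable facts about `S₃`) -/

-- D-0017: single-problem summit, so `Summit.BirchSwinnertonDyer.BirchSwinnertonDyer.…` repeats a namespace BY DESIGN.
namespace Summit.BirchSwinnertonDyer.BirchSwinnertonDyer.Theorems.SteinbergFibreAtTwo

/-- An odd permutation of three letters is one of the three transpositions. [folklore] -/
private theorem perm_fin_three_eq_swap_of_sign_eq_neg_one :
    ∀ t : Equiv.Perm (Fin 3), Equiv.Perm.sign t = -1 →
      t = Equiv.swap 0 1 ∨ t = Equiv.swap 0 2 ∨ t = Equiv.swap 1 2 := by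
  decide

/-- `S₃` as six short words in the transposition `(0 1)` and any permutation `h` moving the letter
`2`. [folklore] -/
private theorem perm_fin_three_eq_word_of_apply_two_ne :
    ∀ h : Equiv.Perm (Fin 3), h 2 ≠ 2 → ∀ k : Equiv.Perm (Fin 3),
      k = 1 ∨ k = Equiv.swap 0 1 ∨ k = h ∨ k = Equiv.swap 0 1 * h ∨ k = h * Equiv.swap 0 1 ∨
        k = Equiv.swap 0 1 * h * Equiv.swap 0 1 := by
  decide

/-- The `3`-cycle `(0 1)(1 2)` moves every letter. [folklore] -/
private theorem swap_mul_swap_apply_ne :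
    ∀ i : Fin 3, (Equiv.swap (0 : Fin 3) 1 * Equiv.swap (1 : Fin 3) 2) i ≠ i := by
  decide

/-- **(G) A normal subgroup of `S₃` containing an odd permutation is all of `S₃`.** An odd
permutation of three letters is a transposition; all transpositions are conjugate
(`Equiv.Perm.isConj_swap`), so a normal subgroup containing one contains all of them; and
transpositions generate the symmetric group (`Equiv.Perm.closure_isSwap`). [folklore] -/
theorem perm_fin_three_subgroup_eq_top_of_normal_of_exists_sign_eq_neg_one :
    ∀ (H : Subgroup (Equiv.Perm (Fin 3))), H.Normal → (∃ t ∈ H, Equiv.Perm.sign t = -1) → H = ⊤ := by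
  intro H hN ht
  obtain ⟨t, htH, ht⟩ := ht
  -- `t` is a transposition `swap x y`
  obtain ⟨x, y, hxy, rfl⟩ : t.IsSwap := by
    rcases perm_fin_three_eq_swap_of_sign_eq_neg_one t ht with rfl | rfl | rfl
    · exact ⟨0, 1, by decide, rfl⟩
    · exact ⟨0, 2, by decide, rfl⟩
    · exact ⟨1, 2, by decide, rfl⟩
  -- every transposition is conjugate to `t`, hence lies in the normal subgroup `H`
  have hswap : ∀ s : Equiv.Perm (Fin 3), s.IsSwap → s ∈ H := by
    rintro s ⟨a, b, hab, rfl⟩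
    obtain ⟨c, hc⟩ := isConj_iff.mp (Equiv.Perm.isConj_swap hxy hab)
    rw [← hc]
    exact hN.conj_mem _ htH c
  -- and transpositions generate `S₃`
  rw [eq_top_iff, ← Equiv.Perm.closure_isSwap, Subgroup.closure_le]
  exact hswap

end Summit.BirchSwinnertonDyer.BirchSwinnertonDyer.Theorems.SteinbergFibreAtTwo

/-! ### §1. `ρ̄_{E,2}` onto `Aut(E[2])` ⇒ `permGal` onto `S₃` -/

noncomputable section

open WeierstrassCurve
open Literature.NumberTheory.EllipticCurves.DokchitserDokchitser2012 Literature.NumberTheory.EllipticCurves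

namespace Summit.BirchSwinnertonDyer.BirchSwinnertonDyer.Theorems.SteinbergFibreAtTwo

section AnyField

variable {K : Type*} [Field K] (W : WeierstrassCurve K) [W.IsElliptic] (h2 : (2 : K) ≠ 0)

/-- **(S) over any field with `2 ≠ 0`: if `ρ̄_{E,2} : Γ_K → Aut(E[2])` is onto, then every
permutation of `{T₀, T₁, T₂}` is `permGal σ` for some `σ ∈ Γ_K`.** Every additive automorphism of
`E[2]` is some `ρ̄₂(σ)`; the transposition `T₀ ↔ T₁` (`swapAut`, `perm_swapAut`) and an automorphism
moving `T₂` (`exists_addEquiv_apply_ne`) are therefore realised, and the realised permutations are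
closed under products (`permGal_mul`), so they exhaust `S₃`.
[cite: SilvermanAEC2009, III.§7 (the representation G_{K̄/K} → Aut(E[m]))] -/
theorem permGal_surjective_of_hasSurjectiveModNGaloisRep_two_of_two_ne_zero
    (hs : W.HasSurjectiveModNGaloisRep 2) : Function.Surjective (permGal W h2) := by
  -- every additive automorphism of `E[2]` is some `ρ̄₂(σ)`
  have hrho : ∀ φ : geomTorsion W 2 ≃+ geomTorsion W 2,
      ∃ σ : Field.absoluteGaloisGroup K, rho W σ = φ := by
    intro φ
    obtain ⟨σ, hσ⟩ := hs (Multiplicative.ofAdd φ)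
    exact ⟨σ, by change (galoisRepTorsion W 2 σ).toAdd = φ; rw [hσ, toAdd_ofAdd]⟩
  -- the transposition `(0 1)` is realised
  obtain ⟨σ, hσ⟩ := hrho (swapAut W h2)
  have hs01 : permGal W h2 σ = Equiv.swap 0 1 := by rw [permGal, hσ, perm_swapAut]
  -- a permutation moving the letter `2` is realised
  have hT2 : T W h2 2 ≠ 0 := fun h ↦ coe_T_ne_zero W h2 2 (by rw [h]; rfl)
  obtain ⟨φ, hφ⟩ := exists_addEquiv_apply_ne W h2 hT2
  obtain ⟨τ, hτ⟩ := hrho φ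
  have hτ2 : permGal W h2 τ 2 ≠ 2 := by
    intro e
    apply hφ
    rw [← hτ, rho_apply, ← T_permGal, e]
  -- the realised permutations are closed under products: all six words are realised
  intro k
  rcases perm_fin_three_eq_word_of_apply_two_ne (permGal W h2 τ) hτ2 k with
    rfl | rfl | rfl | rfl | rfl | rfl
  · exact ⟨1, permGal_one W h2⟩
  · exact ⟨σ, hs01⟩
  · exact ⟨τ, rfl⟩
  · exact ⟨σ * τ, by rw [permGal_mul, hs01]⟩
  · exact ⟨τ * σ, by rw [permGal_mul, hs01]⟩
  · exact ⟨σ * τ * σ, by rw [permGal_mul, permGal_mul, hs01]⟩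

end AnyField

/-- **(S) The surjectivity dictionary over `ℚ`:** `ρ̄_{E,2}` onto `Aut(E[2]) ≅ GL₂(𝔽₂)` makes
`σ ↦ permGal σ`, the permutation action of `Γ_ℚ` on the three nonzero `2`-torsion points, onto `S₃`.
[folklore] -/
theorem permGal_surjective_of_hasSurjectiveModNGaloisRep_two (W : WeierstrassCurve ℚ) [W.IsElliptic]
    (h2 : W.HasSurjectiveModNGaloisRep 2) :
    Function.Surjective (permGal W (two_ne_zero : (2 : ℚ) ≠ 0)) :=
  permGal_surjective_of_hasSurjectiveModNGaloisRep_two_of_two_ne_zero W two_ne_zero h2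

/-! ### §2. The residue statement: `permGal (Gal(ℚ̄/ℚ_∞)) = S₃`, and a `3`-cycle in `Gal(ℚ̄/ℚ_∞)` -/

/-- **(D) `ρ̄_{E,2}` restricted to `Gal(ℚ̄/ℚ_∞)` is still onto `S₃`.** For an elliptic `W/ℚ` with
`ρ̄_{E,2}` onto, a `ℤ₂`-extension `κ` of `ℚ` (Washington §13.1: `κ : Γ_ℚ ↠ ℤ₂`,
`κ.kerSubgroup = Gal(ℚ̄/ℚ_∞)`), and an element `c ∈ κ.kerSubgroup` that is ODD on `{T₀, T₁, T₂}` (on the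
residue: complex conjugation, `Δ < 0`), every permutation of the letters is `permGal σ` for some
`σ ∈ κ.kerSubgroup`. Proof: `σ ↦ permGal σ` is an epimorphism `Γ_ℚ ↠ S₃` (by (S)); `κ.kerSubgroup` is a
kernel, hence normal, so its image is a normal subgroup of `S₃` (`Subgroup.Normal.map`) containing the
odd permutation `permGal c`; by (G) it is `S₃`. [cite: Washington1997, §13.1 (ℤ_p-extensions, Γ = Gal(K_∞/K) ≅ ℤ_p)] -/
theorem permGal_kerSubgroup_surjective_of_sign_eq_neg_one (W : WeierstrassCurve ℚ) [W.IsElliptic]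
    (κ : ZpExtension ℚ 2) (h2 : W.HasSurjectiveModNGaloisRep 2) {c : Field.absoluteGaloisGroup ℚ}
    (hcκ : c ∈ κ.kerSubgroup) (hc : Equiv.Perm.sign (permGal W (two_ne_zero : (2 : ℚ) ≠ 0) c) = -1) :
    ∀ g : Equiv.Perm (Fin 3), ∃ σ ∈ κ.kerSubgroup, permGal W (two_ne_zero : (2 : ℚ) ≠ 0) σ = g := by
  -- `permGal` as a group homomorphism `f : Γ_ℚ →* S₃`, onto by (S)
  let f : Field.absoluteGaloisGroup ℚ →* Equiv.Perm (Fin 3) :=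
    MonoidHom.mk' (permGal W two_ne_zero) (permGal_mul W two_ne_zero)
  have hf : Function.Surjective f :=
    permGal_surjective_of_hasSurjectiveModNGaloisRep_two W h2
  -- `ker κ` is normal in `Γ_ℚ`, so its image `H` is normal in `S₃`
  have hKN : κ.kerSubgroup.Normal := MonoidHom.normal_ker _
  have hHN : (κ.kerSubgroup.map f).Normal := hKN.map f hf
  -- `H` contains the odd permutation `permGal c`, so `H = ⊤` by (G)
  have hH : κ.kerSubgroup.map f = ⊤ :=
    perm_fin_three_subgroup_eq_top_of_normal_of_exists_sign_eq_neg_one _ hHN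
      ⟨f c, Subgroup.mem_map_of_mem f hcκ, hc⟩
  intro g
  have hg : g ∈ κ.kerSubgroup.map f := by rw [hH]; exact Subgroup.mem_top g
  obtain ⟨σ, hσ, hfσ⟩ := Subgroup.mem_map.mp hg
  exact ⟨σ, hσ, hfσ⟩

/-- **(F) A `3`-cycle in `Gal(ℚ̄/ℚ_∞)`: some `σ₀ ∈ κ.kerSubgroup` moves every nonzero `2`-torsion
point.** By (D) the `3`-cycle `(0 1)(1 2)` is `permGal σ₀` with `σ₀ ∈ κ.kerSubgroup`; a nonzero
`P ∈ E[2]` is some `T_i` (`E[2] = {O, T₀, T₁, T₂}`, Silverman III.6.4(b)), and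
`σ₀ T_i = T_{(0 1)(1 2) i} ≠ T_i`.
[cite: SilvermanAEC2009, III.§7 (the representation G_{K̄/K} → Aut(E[m]))] -/
theorem exists_mem_kerSubgroup_forall_smul_ne (W : WeierstrassCurve ℚ) [W.IsElliptic]
    (κ : ZpExtension ℚ 2) (h2 : W.HasSurjectiveModNGaloisRep 2) {c : Field.absoluteGaloisGroup ℚ}
    (hcκ : c ∈ κ.kerSubgroup) (hc : Equiv.Perm.sign (permGal W (two_ne_zero : (2 : ℚ) ≠ 0) c) = -1) :
    ∃ σ₀ ∈ κ.kerSubgroup, ∀ P : WeierstrassCurve.geomTorsion W 2, P ≠ 0 → σ₀ • P ≠ P := by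
  obtain ⟨σ₀, hσ₀, hg⟩ := permGal_kerSubgroup_surjective_of_sign_eq_neg_one W κ h2 hcκ hc
    (Equiv.swap 0 1 * Equiv.swap 1 2)
  refine ⟨σ₀, hσ₀, fun P hP0 hP ↦ ?_⟩
  rcases eq_zero_or_eq_T W two_ne_zero P with rfl | ⟨i, rfl⟩
  · exact hP0 rfl
  · rw [← T_permGal, hg] at hP
    exact swap_mul_swap_apply_ne i (T_injective W two_ne_zero hP)

end Summit.BirchSwinnertonDyer.BirchSwinnertonDyer.Theorems.SteinbergFibreAtTwo

end
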